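import Summits.CriticalPhenomena.CardyFormulaZ2.Theorems.CardyMagicRigidityNestingRigidityNeckRingArcT
import HarnessLib

/-!
# Crux `NestingRigidity`, line `pinch-resampling` (v4), stub S11: rotated arc cells of the hexagonal ring of `𝕋`

Crux `Summit.CriticalPhenomena.CardyFormulaZ2.Theses.CardyMagicRigidity.NestingRigidity` (stmt-CriticalPhenomena-4835),
line `pinch-resampling` v4, stub S11 `stub_neckHookupCoarseT : NeckHookupCoarseT`.  Worker W6c, wave 6: the site-`𝕋` twin of
`…NeckZ2RingCells` (worker W6a), sequel of `…NeckRingArcT` (arc coordinate `triArcPos R d ∈ [0, 6R)` of the hexagonal ring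
`{|d|_𝕋 = R}`, inverse `triArcPt`).  The skeleton of a necklace records the occupied CELLS of the ring at resolution `ℓ`, in
the arc coordinate ROTATED by a cut `c ∈ [0, 6R)` placed inside a largest empty gap (so that the line gaps of
`…GapHierarchy` under-estimate the cyclic ones); here is the dictionary between rotated cells and `𝕋`-norm geometry, in
linear integer arithmetic (adapted verbatim from the `ℤ²` file, `8R ↦ 6R`):

* `NeckCoarse.triRotArc R c d` — arc position measured from the cut, in `[0, 6R)` (`triRotArc_nonneg`, `triRotArc_lt`);
  `triNorm_sub_le_abs_triRotArc_sub` (`|d - d'|_𝕋 ≤ |ã - ã'|`), `min_triRotArc_le_two_mul_triNorm_sub`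
  (`min (|ã - ã'|, 6R - |ã - ã'|) ≤ 2 |d - d'|_𝕋`).
* `NeckCoarse.triRotCell R c ℓ d = ⌊ã / ℓ⌋` — the rotated cell; `triNorm_sub_lt_of_triRotCell`: two ring points whose
  rotated cells differ by `Δ` are at `𝕋`-distance `< (Δ + 1) ℓ`; `le_two_mul_triNorm_sub_of_triRotCell`: conversely
  `min (ℓ Δ - ℓ + 1, 6R - ℓ Δ - ℓ + 1) ≤ 2 |d - d'|_𝕋`.
* `NeckCoarse.triRotCellPt R c ℓ t` — a ring point in the rotated cell `t` (`triRotArc_triRotCellPt : ã = t ℓ`,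
  `triRotCell_triRotCellPt`, `triNorm_triRotCellPt`, `triNorm_triRotCellPt_sub_lt`).
* Registered anchor `triRingCells_dictionary`.
-/

noncomputable section

namespace Summit.CriticalPhenomena.CardyFormulaZ2.Cruxes.NestingRigidity.PinchResampling

open Literature.Probability.Percolation Literature.Probability.LatticeModels

namespace NeckCoarse

/-! ## §1 Rotated arc positions -/

/-- **Rotated arc position**: the arc coordinate measured clockwise from the cut `c`. -/
def triRotArc (R c : ℤ) (d : Site 2) : ℤ :=
  if c ≤ triArcPos R d then triArcPos R d - c else triArcPos R d - c + 6 * R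

variable {R c : ℤ} {d d' : Site 2}

/-- The rotated arc position is nonnegative (cut in `[0, 6R)`). -/
theorem triRotArc_nonneg (hc' : c < 6 * R) (hd : triNorm d = R) : 0 ≤ triRotArc R c d := by
  have h0 := triArcPos_nonneg hd
  unfold triRotArc
  split_ifs <;> omega

/-- The rotated arc position is `< 6R` (cut in `[0, 6R)`, `R ≥ 1`). -/
theorem triRotArc_lt (hR : 1 ≤ R) (hc : 0 ≤ c) (hd : triNorm d = R) : triRotArc R c d < 6 * R := by
  have h1 := triArcPos_lt hR hd
  unfold triRotArc
  split_ifs <;> omega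

/-- **Sup distance ≤ rotated arc distance** (rotation preserves the cyclic arc distance). -/
theorem triNorm_sub_le_abs_triRotArc_sub (hR : 1 ≤ R) (hd : triNorm d = R) (hd' : triNorm d' = R) :
    triNorm (d - d') ≤ |triRotArc R c d - triRotArc R c d'| := by
  have h1 := triNorm_sub_le_triArcDist hd hd'
  have h2 := triNorm_sub_le_triArcDist' hd hd'
  have ha0 := triArcPos_nonneg hd
  have ha1 := triArcPos_lt hR hd
  have hb0 := triArcPos_nonneg hd'
  have hb1 := triArcPos_lt hR hd'
  rw [abs_eq_max_neg] at h1 h2 ⊢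
  unfold triRotArc
  split_ifs <;> omega

/-- **Rotated cyclic arc distance ≤ twice the `𝕋`-distance.** -/
theorem min_triRotArc_le_two_mul_triNorm_sub (hR : 1 ≤ R) (hd : triNorm d = R) (hd' : triNorm d' = R) :
    min |triRotArc R c d - triRotArc R c d'| (6 * R - |triRotArc R c d - triRotArc R c d'|) ≤ 2 * triNorm (d - d') := by
  have h := triArcDist_le_two_mul_triNorm_sub hd hd'
  have ha0 := triArcPos_nonneg hd
  have ha1 := triArcPos_lt hR hd
  have hb0 := triArcPos_nonneg hd'
  have hb1 := triArcPos_lt hR hd'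
  rw [abs_eq_max_neg] at h ⊢
  unfold triRotArc
  split_ifs <;> omega

/-! ## §2 Rotated cells at resolution `ℓ` -/

/-- **Rotated cell** of a ring point at resolution `ℓ`: `⌊triRotArc / ℓ⌋`. -/
def triRotCell (R c ℓ : ℤ) (d : Site 2) : ℤ := triRotArc R c d / ℓ

variable {ℓ : ℤ}

/-- The rotated arc position lies in its cell: `ℓ T̃ ≤ ã < ℓ T̃ + ℓ`. -/
theorem triRotCell_mul_le (hℓ : 0 < ℓ) (d : Site 2) :
    ℓ * triRotCell R c ℓ d ≤ triRotArc R c d ∧ triRotArc R c d < ℓ * triRotCell R c ℓ d + ℓ := by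
  have h := Int.mul_ediv_add_emod (triRotArc R c d) ℓ
  have h0 := Int.emod_nonneg (triRotArc R c d) hℓ.ne'
  have h1 := Int.emod_lt_of_pos (triRotArc R c d) hℓ
  unfold triRotCell
  constructor <;> omega

/-- The rotated cell is nonnegative. -/
theorem triRotCell_nonneg (hℓ : 0 < ℓ) (hc' : c < 6 * R) (hd : triNorm d = R) : 0 ≤ triRotCell R c ℓ d :=
  Int.ediv_nonneg (triRotArc_nonneg hc' hd) hℓ.le

/-- The rotated cell is `< N` as soon as `6R ≤ N ℓ`. -/
theorem triRotCell_lt (hℓ : 0 < ℓ) (hR : 1 ≤ R) (hc : 0 ≤ c) (hd : triNorm d = R) {N : ℤ} (hN : 6 * R ≤ N * ℓ) :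
    triRotCell R c ℓ d < N := by
  have h := (triRotCell_mul_le hℓ d (R := R) (c := c)).1
  have h' := triRotArc_lt hR hc hd
  by_contra hcon
  have hcon' : N ≤ triRotCell R c ℓ d := le_of_not_gt hcon
  have : N * ℓ ≤ ℓ * triRotCell R c ℓ d := by nlinarith
  omega

/-- **Two ring points whose rotated cells differ by `Δ` are at `𝕋`-distance `< (Δ + 1) ℓ`.** -/
theorem triNorm_sub_lt_of_triRotCell (hℓ : 0 < ℓ) (hR : 1 ≤ R) (hd : triNorm d = R) (hd' : triNorm d' = R) :
    triNorm (d - d') < (|triRotCell R c ℓ d - triRotCell R c ℓ d'| + 1) * ℓ := by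
  have h := triNorm_sub_le_abs_triRotArc_sub hR hd hd' (c := c)
  obtain ⟨h1, h2⟩ := triRotCell_mul_le hℓ d (R := R) (c := c)
  obtain ⟨h1', h2'⟩ := triRotCell_mul_le hℓ d' (R := R) (c := c)
  set T := triRotCell R c ℓ d
  set T' := triRotCell R c ℓ d'
  -- `|ã - ã'| < ℓ |T - T'| + ℓ`
  have key : |triRotArc R c d - triRotArc R c d'| < (|T - T'| + 1) * ℓ := by
    rw [abs_lt]
    constructor
    · have : -(|T - T'|) * ℓ ≤ (T - T') * ℓ :=
        mul_le_mul_of_nonneg_right (neg_abs_le _) hℓ.le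
      nlinarith
    · have : (T - T') * ℓ ≤ |T - T'| * ℓ := mul_le_mul_of_nonneg_right (le_abs_self _) hℓ.le
      nlinarith
  exact h.trans_lt key

/-- **Conversely**: `min (ℓ Δ - ℓ + 1) (6R - ℓ Δ - ℓ + 1) ≤ 2 |d - d'|_𝕋`, `Δ` the difference of the rotated cells. -/
theorem le_two_mul_triNorm_sub_of_triRotCell (hℓ : 0 < ℓ) (hR : 1 ≤ R) (hd : triNorm d = R) (hd' : triNorm d' = R) :
    min (ℓ * |triRotCell R c ℓ d - triRotCell R c ℓ d'| - ℓ + 1)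
      (6 * R - ℓ * |triRotCell R c ℓ d - triRotCell R c ℓ d'| - ℓ + 1) ≤ 2 * triNorm (d - d') := by
  have h := min_triRotArc_le_two_mul_triNorm_sub hR hd hd' (c := c)
  obtain ⟨h1, h2⟩ := triRotCell_mul_le hℓ d (R := R) (c := c)
  obtain ⟨h1', h2'⟩ := triRotCell_mul_le hℓ d' (R := R) (c := c)
  set T := triRotCell R c ℓ d
  set T' := triRotCell R c ℓ d'
  set A := triRotArc R c d
  set A' := triRotArc R c d'
  -- `ℓ |T - T'| - ℓ < |A - A'| < ℓ |T - T'| + ℓ`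
  have hlo : ℓ * |T - T'| - ℓ < |A - A'| := by
    rcases le_total T T' with hTT | hTT
    · rw [abs_of_nonpos (sub_nonpos.2 hTT)]
      have : ℓ * (T' - T) - ℓ < A' - A := by nlinarith
      have h3 : A' - A ≤ |A - A'| := by rw [abs_sub_comm]; exact le_abs_self _
      linarith
    · rw [abs_of_nonneg (sub_nonneg.2 hTT)]
      have : ℓ * (T - T') - ℓ < A - A' := by nlinarith
      have h3 : A - A' ≤ |A - A'| := le_abs_self _
      linarith
  have hhi : |A - A'| < ℓ * |T - T'| + ℓ := by
    rw [abs_lt]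
    constructor
    · have : -(ℓ * |T - T'|) ≤ ℓ * (T - T') := by
        have := mul_le_mul_of_nonneg_left (neg_abs_le (T - T')) hℓ.le
        linarith
      nlinarith
    · have : ℓ * (T - T') ≤ ℓ * |T - T'| := mul_le_mul_of_nonneg_left (le_abs_self _) hℓ.le
      nlinarith
  have key : min (ℓ * |T - T'| - ℓ + 1) (6 * R - ℓ * |T - T'| - ℓ + 1) ≤ min |A - A'| (6 * R - |A - A'|) := by
    apply min_le_min <;> omega
  exact key.trans h

/-! ## §3 Ring points of rotated cells -/

/-- **A ring point in the rotated cell `t`**: the point of arc coordinate `t ℓ + c (mod 6R)`. -/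
def triRotCellPt (R c ℓ t : ℤ) : Site 2 :=
  triArcPt R (if t * ℓ + c < 6 * R then t * ℓ + c else t * ℓ + c - 6 * R)

variable {t : ℤ}

/-- The point of the rotated cell `t` lies on the ring (`0 ≤ t`, `t ℓ < 6R`, cut in `[0, 6R)`). -/
theorem triNorm_triRotCellPt (hℓ : 0 < ℓ) (hc : 0 ≤ c) (hc' : c < 6 * R) (ht : 0 ≤ t) (ht' : t * ℓ < 6 * R) :
    triNorm (triRotCellPt R c ℓ t) = R := by
  have : 0 ≤ t * ℓ := mul_nonneg ht hℓ.le
  unfold triRotCellPt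
  split_ifs with h
  · exact triNorm_triArcPt (by omega) h
  · exact triNorm_triArcPt (by omega) (by omega)

/-- The rotated arc position of the point of the rotated cell `t` is exactly `t ℓ`. -/
theorem triRotArc_triRotCellPt (hℓ : 0 < ℓ) (hc' : c < 6 * R) (ht : 0 ≤ t) (ht' : t * ℓ < 6 * R) :
    triRotArc R c (triRotCellPt R c ℓ t) = t * ℓ := by
  have h0 : 0 ≤ t * ℓ := mul_nonneg ht hℓ.le
  unfold triRotArc triRotCellPt
  split_ifs with h h' h'
  · rw [triArcPos_triArcPt h]; ring
  · rw [triArcPos_triArcPt h] at h'; omega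
  · rw [triArcPos_triArcPt (by omega)] at h'; omega
  · rw [triArcPos_triArcPt (by omega)]; ring

/-- The rotated cell of the point of the rotated cell `t` is `t`. -/
theorem triRotCell_triRotCellPt (hℓ : 0 < ℓ) (hc' : c < 6 * R) (ht : 0 ≤ t) (ht' : t * ℓ < 6 * R) :
    triRotCell R c ℓ (triRotCellPt R c ℓ t) = t := by
  rw [triRotCell, triRotArc_triRotCellPt hℓ hc' ht ht', Int.mul_ediv_cancel _ hℓ.ne']

/-- **The point of the rotated cell `t` is within `𝕋`-distance `< (|t - T̃(d)| + 1) ℓ` of every ring point `d`.** -/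
theorem triNorm_triRotCellPt_sub_lt (hℓ : 0 < ℓ) (hR : 1 ≤ R) (hc : 0 ≤ c) (hc' : c < 6 * R) (ht : 0 ≤ t)
    (ht' : t * ℓ < 6 * R) (hd : triNorm d = R) :
    triNorm (triRotCellPt R c ℓ t - d) < (|t - triRotCell R c ℓ d| + 1) * ℓ := by
  have h := triNorm_sub_lt_of_triRotCell hℓ hR (triNorm_triRotCellPt hℓ hc hc' ht ht') hd (c := c)
  rwa [triRotCell_triRotCellPt hℓ hc' ht ht'] at h

end NeckCoarse

/-- **Dictionary between rotated ring cells and `𝕋`-norm geometry (registered helper, anchor of this module on the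
crux item).**  For a cut `c ∈ [0, 6R)`, resolution `ℓ ≥ 1` and ring points `d, d'` (`|d|_𝕋 = |d'|_𝕋 = R ≥ 1`) with
rotated cells `T̃, T̃'`: `|d - d'|_𝕋 < (|T̃ - T̃'| + 1) ℓ`; `min (ℓ |T̃ - T̃'| - ℓ + 1) (6R - ℓ |T̃ - T̃'| - ℓ + 1) ≤
2 |d - d'|_𝕋`; and for `0 ≤ t`, `t ℓ < 6R` the point `triRotCellPt R c ℓ t` is a ring point of rotated cell `t` within sup
distance `< (|t - T̃| + 1) ℓ` of `d`. -/
theorem triRingCells_dictionary : ∀ (R c ℓ : ℤ) (d d' : Site 2), 0 < ℓ → 1 ≤ R → 0 ≤ c → c < 6 * R → triNorm d = R → triNorm d' = R → triNorm (d - d') < (|NeckCoarse.triRotCell R c ℓ d - NeckCoarse.triRotCell R c ℓ d'| + 1) * ℓ ∧ min (ℓ * |NeckCoarse.triRotCell R c ℓ d - NeckCoarse.triRotCell R c ℓ d'| - ℓ + 1) (6 * R - ℓ * |NeckCoarse.triRotCell R c ℓ d - NeckCoarse.triRotCell R c ℓ d'| - ℓ + 1) ≤ 2 * triNorm (d - d')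 ∧ ∀ t : ℤ, 0 ≤ t → t * ℓ < 6 * R → triNorm (NeckCoarse.triRotCellPt R c ℓ t) = R ∧ NeckCoarse.triRotCell R c ℓ (NeckCoarse.triRotCellPt R c ℓ t) = t ∧ triNorm (NeckCoarse.triRotCellPt R c ℓ t - d) < (|t - NeckCoarse.triRotCell R c ℓ d| + 1) * ℓ :=
  fun _ _ _ _ _ hℓ hR hc hc' hd hd' ↦ ⟨NeckCoarse.triNorm_sub_lt_of_triRotCell hℓ hR hd hd',
    NeckCoarse.le_two_mul_triNorm_sub_of_triRotCell hℓ hR hd hd', fun _ ht ht' ↦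
      ⟨NeckCoarse.triNorm_triRotCellPt hℓ hc hc' ht ht', NeckCoarse.triRotCell_triRotCellPt hℓ hc' ht ht',
        NeckCoarse.triNorm_triRotCellPt_sub_lt hℓ hR hc hc' ht ht' hd⟩⟩

end Summit.CriticalPhenomena.CardyFormulaZ2.Cruxes.NestingRigidity.PinchResampling

end
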